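import Summits.BirchSwinnertonDyer.BirchSwinnertonDyer.Theorems.ManinLocalTwoThreeDeltaHomDiamond
import Summits.BirchSwinnertonDyer.BirchSwinnertonDyer.Theorems.ManinLocalTwoThreeCuspSymbolBoundary
import Summits.BirchSwinnertonDyer.Rank1Residual.ManinAdditive.RelativeIharaShiftVanishingEdges
import Mathlib.Topology.Compactification.OnePoint.ProjectiveLine
import HarnessLib

/-!
# The diamond bottom of E-es-35 at symbol level: a cusp symbol invariant under `Δ_t(N)` has a DIAMOND boundary map
# `γ ↦ Φ(∞, γ∞) = η(d_γ mod N)` on `Γ₀(L)` (LEMMA G's conclusion ⟹ the second disjunct of `ShiftInvariantIsDiamond`)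

Summit `BirchSwinnertonDyer`, route `ManinLocalTwoThree` (cell bsd-f2-manin), deciding crux C2 `ManinOddAtFour`
(stmt-BirchSwinnertonDyer-22967) and crux C3 `ManinPrimeToThreeAtNine` (stmt-BirchSwinnertonDyer-22968), through the
generation stubs (E-es-22 / E-es-19) ⟸ leaf E-es-25 `RelativeIharaShiftVanishingBar` ⟸ (sibling file
`Theorems/ManinLocalTwoThreeDiamondEisenstein.lean`) E-es-35 `ShiftInvariantIsDiamond` alone.  The planner's proof of
E-es-35 (bsd-f2-manin-es g11, HOME/MEMO-es.md §23): lift the shift-invariant class `u ∈ Hom(Γ₀(L), K)` to a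
`Γ₀(L)`-invariant cusp symbol `Φ` on `P¹(ℚ)` (E-es-29a, p2's `Theorems/ManinLocalTwoThreeCuspSymbolBoundary.lean`) which is
also invariant under `A_t^n` (E-es-30 + eigen-glue); LEMMA G (E-es-31, p1) upgrades the invariance group to contain the
image of `Δ_t(N) ≤ SL₂(ℤ[1/t])`, `N` the `t`-free part of `L`; THEN — this file — the boundary map of `Φ` is a diamond
function on `Γ₀(L)`, by E-es-34 (`Theorems/ManinLocalTwoThreeDeltaHomDiamond.lean`, from Vaserstein's theorem over
`ℤ[1/t]`) applied to `φ(g) := Φ(∞, j(g)∞)`, which is additive on `Δ_t(N)` (p2's `cuspSymbol_delta_mul`) and kills the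
unipotents `U⁺(x)` (fix `∞`) and `U⁻(Ny)` (fix `0`) (p2's `cuspSymbol_delta_eq_zero_of_smul_eq`).

* `exists_diamondFun_of_cuspSymbol_invariant` — ABSTRACT embedding: for any hom `j : SL₂(ℤ[1/t]) →* GL₂(ℚ)` with
  `j ∘ ι = mapGL ℚ` such that each `j(U⁺(x))`, `j(U⁻(Ny))` has a fixed point on `P¹(ℚ)`, a symbol invariant under
  `j(Δ_t(N))` has boundary map `(γ ↦ Φ(∞, γ∞)) = diamondFun L N K η` on `Γ₀(L)` (`N ∣ L`, `t ≥ 2`), `η` additive on units.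
* `exists_diamondFun_of_cuspSymbol_invariant_map` — CONCRETE embedding `j = toGL ∘ SL₂(f)` for any ring map
  `f : ℤ[1/t] →+* ℚ` (the sketch's `awayToGL`): the three side conditions are discharged
  (`toGL_map_iota_eq_mapGL`, `toGL_map_upperUnip_smul_infty`, `toGL_map_lowerUnip_smul_zero`).

So, granted LEMMA G at symbol level (es's `SymbolInvariantUnderDelta`: `Γ₀(L)`- and `A_t^n`-invariance ⟹ invariance
under `j(Δ_t(N))`), the lifted symbol's class is `diamondFun`, and `eq_zero_of_coe_eq_diamondFun` (sibling file) ends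
E-es-25.  Nothing here is specific to elliptic curves; nothing about BSD or Manin's conjecture is proved by this file.

References: HOME/MEMO-es.md §23; HOME/es/Sketch-es-g11.lean §5–§7 (rows E-es-31/34/35); L. N. Vaserstein, Mat. Sb. 89
(1972) (tree theorem `SL2Rel.Away.relG_top_span_natCast_le_relE`); G. Stevens, *Arithmetic on modular curves* (1982)
Ch. 1 (boundary symbols).
-/

set_option autoImplicit false
set_option linter.dupNamespace false

open scoped MatrixGroups

open CongruenceSubgroup Matrix.SpecialLinearGroup
  Literature.NumberTheory.EllipticCurves.ModularForms.HidaCohomology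
  Summit.BirchSwinnertonDyer.BirchSwinnertonDyer.Theorems.ConjSpanGenAllLevels
  Summit.BirchSwinnertonDyer.Rank1Residual.ManinAdditive

namespace Summit.BirchSwinnertonDyer.BirchSwinnertonDyer.Theorems.ManinLocalTwoThree

noncomputable section

/-! ### §1  Abstract embedding `j : SL₂(ℤ[1/t]) →* GL₂(ℚ)` -/

section Abstract

variable {t N L : ℕ} {K : Type*} [CommRing K]

/-- **LEMMA G's conclusion ⟹ diamond boundary map.**  Let `Φ` be an additive symbol on `P¹(ℚ)` invariant under
`j(Δ_t(N))` for a homomorphism `j : SL₂(ℤ[1/t]) →* GL₂(ℚ)` extending `mapGL ℚ` on `SL₂(ℤ)` such that every `j(U⁺(x))`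
and every `j(U⁻(Ny))` fixes a point of `P¹(ℚ)`.  Then for `t ≥ 2`, `N ≥ 1`, `N ∣ L` the boundary map of `Φ` on `Γ₀(L)`
is a diamond function: `(γ ↦ Φ(∞, γ∞)) = diamondFun L N K η` with `η` additive on the units of `ℤ/N`.
Proof: E-es-34 (`exists_diamond_of_deltaHom_of_dvd`) for `φ(g) = Φ(∞, j(g)∞)`. [folklore] -/
theorem exists_diamondFun_of_cuspSymbol_invariant (ht : 2 ≤ t) [NeZero N] (hNL : N ∣ L)
    (Φ : OnePoint ℚ → OnePoint ℚ → K) (hsym : ∀ a b c, Φ a b + Φ b c = Φ a c)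
    (j : SL(2, Away t) →* GL (Fin 2) ℚ) (hj : ∀ γ : SL(2, ℤ), j (iota t γ) = mapGL ℚ γ)
    (hjU : ∀ x : Away t, ∃ c : OnePoint ℚ, j (upperUnip x) • c = c)
    (hjL : ∀ y : Away t, ∃ c : OnePoint ℚ, j (lowerUnip ((N : Away t) * y)) • c = c)
    (hinv : ∀ g ∈ Delta t N, ∀ a b, Φ (j g • a) (j g • b) = Φ a b) :
    ∃ η : ZMod N → K, (∀ a b : ZMod N, IsUnit a → IsUnit b → η (a * b) = η a + η b) ∧
      (fun (γ : Gamma0 L) (_ : Fin 1) => Φ OnePoint.infty (mapGL ℚ (γ : SL(2, ℤ)) • OnePoint.infty)) =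
        diamondFun L N K η := by
  -- `φ(g) := Φ(∞, j g ∞)` is `Δ`-additive and kills the unipotents
  set φ : SL(2, Away t) → K := fun g => Φ OnePoint.infty (j g • OnePoint.infty) with hφ
  have hadd : ∀ g ∈ Delta t N, ∀ g' ∈ Delta t N, φ (g * g') = φ g + φ g' := by
    intro g hg g' _
    simp only [hφ, map_mul]
    exact cuspSymbol_delta_mul Φ hsym (hinv g hg) (j g') OnePoint.infty
  have hU : ∀ x : Away t, φ (upperUnip x) = 0 := by
    intro x
    obtain ⟨c, hc⟩ := hjU x
    exact cuspSymbol_delta_eq_zero_of_smul_eq Φ hsym (hinv _ (upperUnip_mem_Delta x)) hc OnePoint.infty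
  have hL : ∀ y : Away t, φ (lowerUnip ((N : Away t) * y)) = 0 := by
    intro y
    obtain ⟨c, hc⟩ := hjL y
    exact cuspSymbol_delta_eq_zero_of_smul_eq Φ hsym (hinv _ (lowerUnip_mul_mem_Delta y)) hc OnePoint.infty
  obtain ⟨η, hη, h⟩ := exists_diamond_of_deltaHom_of_dvd φ hadd hU hL ht hNL
  refine ⟨η, hη, ?_⟩
  funext γ i
  rw [diamondFun_apply, ← h γ]
  simp only [hφ, hj]

end Abstract

/-! ### §2  The concrete embedding `toGL ∘ SL₂(f)`, `f : ℤ[1/t] →+* ℚ` -/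

section Concrete

variable {t N : ℕ} (f : Away t →+* ℚ)

/-- `toGL ∘ SL₂(f) ∘ ι = mapGL ℚ` on `SL₂(ℤ)` (a ring map `ℤ[1/t] → ℚ` restricts to the unique `ℤ → ℚ`). [folklore] -/
theorem toGL_map_iota_eq_mapGL (γ : SL(2, ℤ)) :
    (toGL : SL(2, ℚ) →* GL (Fin 2) ℚ).comp (map f) (iota t γ) = mapGL ℚ γ := by
  rw [MonoidHom.comp_apply, mapGL, MonoidHom.comp_apply]
  congr 1
  ext i j
  simp

/-- Entries of `toGL (SL₂(f) g)` are `f` of the entries of `g` (plumbing). [folklore] -/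
theorem toGL_map_apply (g : SL(2, Away t)) (i k : Fin 2) :
    ((toGL : SL(2, ℚ) →* GL (Fin 2) ℚ).comp (map f) g : GL (Fin 2) ℚ) i k = f (g i k) := rfl

/-- `j(U⁺(x))` fixes `∞`. [folklore] -/
theorem toGL_map_upperUnip_smul_infty (x : Away t) :
    (toGL : SL(2, ℚ) →* GL (Fin 2) ℚ).comp (map f) (upperUnip x) • (OnePoint.infty : OnePoint ℚ) = OnePoint.infty := by
  rw [OnePoint.smul_infty_eq_self_iff, toGL_map_apply]
  simp [upperUnip]

/-- `j(U⁻(y))` fixes `0`. [folklore] -/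
theorem toGL_map_lowerUnip_smul_zero (y : Away t) :
    (toGL : SL(2, ℚ) →* GL (Fin 2) ℚ).comp (map f) (lowerUnip y) • ((0 : ℚ) : OnePoint ℚ) = ((0 : ℚ) : OnePoint ℚ) := by
  rw [OnePoint.smul_some_eq_ite]
  simp [lowerUnip]

variable {L : ℕ} {K : Type*} [CommRing K]

/-- **LEMMA G's conclusion ⟹ diamond boundary map, concrete embedding.**  For any ring map `f : ℤ[1/t] →+* ℚ`
(`t ≥ 2`; the sketch's `awayToRat`), an additive symbol `Φ` on `P¹(ℚ)` invariant under `toGL(SL₂(f)(Δ_t(N)))` has boundary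
map `(γ ↦ Φ(∞, γ∞)) = diamondFun L N K η` on `Γ₀(L)` (`N ≥ 1`, `N ∣ L`), `η` additive on the units of `ℤ/N`. [folklore] -/
theorem exists_diamondFun_of_cuspSymbol_invariant_map (ht : 2 ≤ t) [NeZero N] (hNL : N ∣ L)
    (Φ : OnePoint ℚ → OnePoint ℚ → K) (hsym : ∀ a b c, Φ a b + Φ b c = Φ a c)
    (hinv : ∀ g ∈ Delta t N, ∀ a b,
      Φ ((toGL : SL(2, ℚ) →* GL (Fin 2) ℚ).comp (map f) g • a) ((toGL : SL(2, ℚ) →* GL (Fin 2) ℚ).comp (map f) g • b) =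
        Φ a b) :
    ∃ η : ZMod N → K, (∀ a b : ZMod N, IsUnit a → IsUnit b → η (a * b) = η a + η b) ∧
      (fun (γ : Gamma0 L) (_ : Fin 1) => Φ OnePoint.infty (mapGL ℚ (γ : SL(2, ℤ)) • OnePoint.infty)) =
        diamondFun L N K η :=
  exists_diamondFun_of_cuspSymbol_invariant ht hNL Φ hsym _ (toGL_map_iota_eq_mapGL f)
    (fun x => ⟨OnePoint.infty, toGL_map_upperUnip_smul_infty f x⟩)
    (fun y => ⟨((0 : ℚ) : OnePoint ℚ), toGL_map_lowerUnip_smul_zero f ((N : Away t) * y)⟩) hinv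

end Concrete

end

end Summit.BirchSwinnertonDyer.BirchSwinnertonDyer.Theorems.ManinLocalTwoThree
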